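import Literature.NumberTheory.Automorphic.AutomorphicFormsGKModuleProofs
import Literature.NumberTheory.Automorphic.AutomorphicFormsProofs
import Literature.NumberTheory.Automorphic.AutomorphicRepDataSplitCenter
import Literature.NumberTheory.Automorphic.GKCohomologyFunctor
import HarnessLib

/-!
# The `(𝔤, K_∞)`-cohomology of an automorphic representation and its smooth `G(𝔸_f)`-action

Topic `NumberTheory/Automorphic`; namespaces `Literature.NumberTheory.Automorphic` (generic part)
and `….AutomorphicRepData`.  Definitions with bodies and theorems; no named fact, no `sorry`.

Generic (`G : RealMatrixGroup A N`, `(𝔤, K)`-module data `(ρK, ρ𝔤)` with the compatibility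
axiom `had`; `GKCohomology`, `GKCohomologyFunctor`):

* `gkCohomologyMap_congr`, `gkCohomologyMap_one`, `gkCohomologyMap_mul`, `mul_comm𝔤`,
  `mul_commK` — the endomorphism functoriality of `H^q(𝔤, K; V)` in multiplicative form;
* `gkCohomologyRep G ρK ρ𝔤 had r hr𝔤 hrK q : Representation ℂ Γ (H^q(𝔤, K; V))` — **a group `Γ`
  acting on `V` by `(𝔤, K)`-maps acts on `H^q(𝔤, K; V)`** [cite: BorelWallach2000, I §5.1].

Automorphic (`π : AutomorphicRepData 𝒟`, Borel–Jacquet's `W' < W ≤ 𝒜`, `W / W'` with its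
`K_∞`-action `π.kRep`, Lie algebra action `ρ𝔤` (`π.HasLieAction ρ𝔤`) and `G(𝔸_f)`-action
`π.finiteRep`, `AutomorphicForms`):

* `AutomorphicRepData.finiteRep_comm_of_hasLieAction` — right translations by `G(𝔸_f)` commute
  with the Lie algebra action (`AutomorphyDatum.commute_ofArch`,
  `lieDeriv_rightTranslation_of_forall_commute`); `finiteRep_comm_kRep`;
* `AutomorphicRepData.gkCohomology π h𝒟 hρ q` — **`H^q(𝔤, K_∞; π) := H^q(𝔤, K_∞; W / W')`** for a
  regular datum (the compatibility axiom from `isGKModule_of_hasLieAction_holds`)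
  [cite: BorelWallach2000, I §5.1];
* `AutomorphicRepData.cohomologyRep π h𝒟 hρ q : Representation ℂ G(𝔸_f) (H^q(𝔤, K_∞; π))` —
  **`G(𝔸_f)` acts on it** through right translations, and `cohomologyRep_isSmooth` — **smoothly**
  (`Representation.IsSmooth`: a class is a cocycle, an alternating map on the finite-dimensional
  `𝔤` determined by finitely many values, each fixed by an open subgroup by
  `isSmooth_finiteRep_holds`) [cite: BorelJacquet1979, 4.6 with 4.2(a), 4.3].

These are the automorphic-side objects `H^q(𝔤, K_∞; π) = H^q(𝔤, K_∞; π_∞) ⊗ π_f` of the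
Eichler–Shimura–Harder / Borel–Franke description of the cohomology of arithmetic groups.

## Mathlib / Literature search

Everything builds on the tree (`AutomorphicForms*`, `GKCohomology*`, `SmoothRepresentation`);
Mathlib has neither automorphic forms nor relative Lie algebra cohomology.
`lean search 'cohomologyRep|gkCohomologyRep'`: no hits.

## References

* A. Borel, H. Jacquet, *Automorphic forms and automorphic representations*, Proc. Sympos. Pure
  Math. 33.1 (1979), 4.2–4.6 [BorelJacquet1979].
* A. Borel, N. Wallach (2000), I §5.1 (held) [BorelWallach2000].
-/

noncomputable section

namespace Literature.NumberTheory.Automorphic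

open Module Literature.Algebra.Lie

-- Mathlib idiom (as in `GKModules`): commutator bracket on `Module.End`
attribute [local instance 100] LieRing.ofAssociativeRing

section Generic

variable {A : Type*} [NormedCommRing A] [NormedAlgebra ℝ A] [NormedAlgebra ℚ A] [CompleteSpace A]
  [StarRing A] [StarModule ℝ A] {N : Type*} [Fintype N] [DecidableEq N] (G : RealMatrixGroup A N)
  {V : Type*} [AddCommGroup V] [Module ℂ V]
  (ρK : Representation ℂ G.maximalCompact V) (ρ𝔤 : G.lie →ₗ⁅ℝ⁆ Module.End ℂ V)
  (had : ∀ (k : G.maximalCompact) (X : G.lie),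
    ρK k ∘ₗ ρ𝔤 X ∘ₗ ρK k⁻¹ = ρ𝔤 (G.Ad (Subgroup.inclusion G.maximalCompact_le_carrier k) X))

/-- The induced endomorphism of `H^q(𝔤, K; V)` depends only on `T` (not on the commutation
proofs). [folklore] -/
theorem gkCohomologyMap_congr {T T' : V →ₗ[ℂ] V} (h : T = T')
    (hT𝔤 : ∀ X : G.lie, T ∘ₗ ρ𝔤 X = ρ𝔤 X ∘ₗ T) (hTK : ∀ k : G.maximalCompact, T ∘ₗ ρK k = ρK k ∘ₗ T)
    (hT'𝔤 : ∀ X : G.lie, T' ∘ₗ ρ𝔤 X = ρ𝔤 X ∘ₗ T')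
    (hT'K : ∀ k : G.maximalCompact, T' ∘ₗ ρK k = ρK k ∘ₗ T') (q : ℕ) :
    gkCohomologyMap G ρK ρ𝔤 had T hT𝔤 hTK q = gkCohomologyMap G ρK ρ𝔤 had T' hT'𝔤 hT'K q := by
  subst h
  rfl

/-- `H^q(1) = 1`. [cite: BorelWallach2000, I §1.2] -/
theorem gkCohomologyMap_one
    (h𝔤 : ∀ X : G.lie, (1 : V →ₗ[ℂ] V) ∘ₗ ρ𝔤 X = ρ𝔤 X ∘ₗ 1)
    (hK : ∀ k : G.maximalCompact, (1 : V →ₗ[ℂ] V) ∘ₗ ρK k = ρK k ∘ₗ 1)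
    (q : ℕ) (x : gkCohomology G ρK ρ𝔤 had q) :
    gkCohomologyMap G ρK ρ𝔤 had 1 h𝔤 hK q x = x :=
  gkCohomologyHom_id G ρK ρ𝔤 had q x

/-- `H^q(T * T') = H^q(T) ∘ H^q(T')`. [cite: BorelWallach2000, I §1.2] -/
theorem gkCohomologyMap_mul {T T' : V →ₗ[ℂ] V}
    (hT𝔤 : ∀ X : G.lie, T ∘ₗ ρ𝔤 X = ρ𝔤 X ∘ₗ T) (hTK : ∀ k : G.maximalCompact, T ∘ₗ ρK k = ρK k ∘ₗ T)
    (hT'𝔤 : ∀ X : G.lie, T' ∘ₗ ρ𝔤 X = ρ𝔤 X ∘ₗ T')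
    (hT'K : ∀ k : G.maximalCompact, T' ∘ₗ ρK k = ρK k ∘ₗ T')
    (h𝔤 : ∀ X : G.lie, (T * T') ∘ₗ ρ𝔤 X = ρ𝔤 X ∘ₗ (T * T'))
    (hK : ∀ k : G.maximalCompact, (T * T') ∘ₗ ρK k = ρK k ∘ₗ (T * T'))
    (q : ℕ) (x : gkCohomology G ρK ρ𝔤 had q) :
    gkCohomologyMap G ρK ρ𝔤 had (T * T') h𝔤 hK q x =
      gkCohomologyMap G ρK ρ𝔤 had T hT𝔤 hTK q (gkCohomologyMap G ρK ρ𝔤 had T' hT'𝔤 hT'K q x) :=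
  gkCohomologyHom_comp G ρK ρ𝔤 ρK ρ𝔤 ρK ρ𝔤 had had had T' hT'𝔤 hT'K T hT𝔤 hTK h𝔤 hK q x

omit [StarModule ℝ A] in
/-- Commutation relations are stable under products. [folklore] -/
theorem mul_comm𝔤 {T T' : V →ₗ[ℂ] V} (hT𝔤 : ∀ X : G.lie, T ∘ₗ ρ𝔤 X = ρ𝔤 X ∘ₗ T)
    (hT'𝔤 : ∀ X : G.lie, T' ∘ₗ ρ𝔤 X = ρ𝔤 X ∘ₗ T') (X : G.lie) :
    (T * T') ∘ₗ ρ𝔤 X = ρ𝔤 X ∘ₗ (T * T') := by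
  rw [Module.End.mul_eq_comp, LinearMap.comp_assoc, hT'𝔤, ← LinearMap.comp_assoc, hT𝔤,
    LinearMap.comp_assoc]

omit [StarModule ℝ A] in
/-- Commutation relations for `K` are stable under products. [folklore] -/
theorem mul_commK {T T' : V →ₗ[ℂ] V} (hTK : ∀ k : G.maximalCompact, T ∘ₗ ρK k = ρK k ∘ₗ T)
    (hT'K : ∀ k : G.maximalCompact, T' ∘ₗ ρK k = ρK k ∘ₗ T') (k : G.maximalCompact) :
    (T * T') ∘ₗ ρK k = ρK k ∘ₗ (T * T') := by
  rw [Module.End.mul_eq_comp, LinearMap.comp_assoc, hT'K, ← LinearMap.comp_assoc, hTK,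
    LinearMap.comp_assoc]

/-- **A group acting on `V` by `(𝔤, K)`-maps acts on `H^q(𝔤, K; V)`.**
[cite: BorelWallach2000, I §5.1] -/
def gkCohomologyRep {Γ : Type*} [Group Γ] (r : Representation ℂ Γ V)
    (hr𝔤 : ∀ (γ : Γ) (X : G.lie), r γ ∘ₗ ρ𝔤 X = ρ𝔤 X ∘ₗ r γ)
    (hrK : ∀ (γ : Γ) (k : G.maximalCompact), r γ ∘ₗ ρK k = ρK k ∘ₗ r γ) (q : ℕ) :
    Representation ℂ Γ (gkCohomology G ρK ρ𝔤 had q) where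
  toFun γ := gkCohomologyMap G ρK ρ𝔤 had (r γ) (hr𝔤 γ) (hrK γ) q
  map_one' := by
    refine LinearMap.ext fun x => ?_
    rw [gkCohomologyMap_congr G ρK ρ𝔤 had (map_one r) (hr𝔤 1) (hrK 1)
      (fun _ => LinearMap.ext fun _ => rfl) (fun _ => LinearMap.ext fun _ => rfl)]
    exact gkCohomologyMap_one G ρK ρ𝔤 had _ _ q x
  map_mul' γ γ' := by
    refine LinearMap.ext fun x => ?_
    rw [gkCohomologyMap_congr G ρK ρ𝔤 had (map_mul r γ γ') (hr𝔤 _) (hrK _)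
      (mul_comm𝔤 G ρ𝔤 (hr𝔤 γ) (hr𝔤 γ')) (mul_commK G ρK (hrK γ) (hrK γ'))]
    exact gkCohomologyMap_mul G ρK ρ𝔤 had (hr𝔤 γ) (hrK γ) (hr𝔤 γ') (hrK γ') _ _ q x

/-- Unfolding. [folklore] -/
@[simp] theorem gkCohomologyRep_apply {Γ : Type*} [Group Γ] (r : Representation ℂ Γ V)
    (hr𝔤 : ∀ (γ : Γ) (X : G.lie), r γ ∘ₗ ρ𝔤 X = ρ𝔤 X ∘ₗ r γ)
    (hrK : ∀ (γ : Γ) (k : G.maximalCompact), r γ ∘ₗ ρK k = ρK k ∘ₗ r γ) (q : ℕ) (γ : Γ) :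
    gkCohomologyRep G ρK ρ𝔤 had r hr𝔤 hrK q γ =
      gkCohomologyMap G ρK ρ𝔤 had (r γ) (hr𝔤 γ) (hrK γ) q := rfl

end Generic

/-! ### Automorphic representations -/

namespace AutomorphicRepData

variable {K : Type} [Field K] [NumberField K]
  {A : Type*} [NormedCommRing A] [NormedAlgebra ℝ A] [NormedAlgebra ℚ A] [CompleteSpace A]
  [StarRing A] {N : Type*} [Fintype N] [DecidableEq N]
  {𝒢 : AdelicGroupData K} {𝒟 : AutomorphyDatum 𝒢 A N} (π : AutomorphicRepData 𝒟)

/-- Right translation by `G(𝔸_f)` on `W / W'` commutes with the Lie algebra action (the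
archimedean one-parameter groups commute with `G(𝔸_f)`, `AutomorphyDatum.commute_ofArch`).
[cite: BorelJacquet1979, 4.6] -/
theorem finiteRep_comm_of_hasLieAction {ρ𝔤 : 𝒟.arch.lie →ₗ⁅ℝ⁆ Module.End ℂ π.Quot}
    (hρ : π.HasLieAction ρ𝔤) (h : 𝒟.finiteAdelic) (X : 𝒟.arch.lie) :
    π.finiteRep h ∘ₗ ρ𝔤 X = ρ𝔤 X ∘ₗ π.finiteRep h := by
  refine Submodule.linearMap_qext _ (LinearMap.ext fun φ => ?_)
  simp only [LinearMap.coe_comp, Function.comp_apply, Submodule.mkQ_apply]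
  change π.finiteRep h (ρ𝔤 X (π.mkQ φ)) = ρ𝔤 X (π.finiteRep h (Submodule.Quotient.mk φ))
  rw [hρ X φ, finiteRep_mk]
  change π.finiteRep h (π.mkQ (π.lieDerivW X φ)) = ρ𝔤 X (π.mkQ _)
  rw [hρ X]
  change π.finiteRep h (Submodule.Quotient.mk (π.lieDerivW X φ)) = _
  rw [finiteRep_mk]
  congr 1
  refine Subtype.ext ?_
  change rightTranslation 𝒢 (h : 𝒢.Adelic) (lieDeriv 𝒟.ofArch X φ) =
    lieDeriv 𝒟.ofArch X (rightTranslation 𝒢 (h : 𝒢.Adelic) φ)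
  exact (lieDeriv_rightTranslation_of_forall_commute X
    (fun t => 𝒟.commute_ofArch _ _ h.2) _).symm

/-- Right translation by `G(𝔸_f)` commutes with `K_∞` on `W / W'` (restated with `∘ₗ`;
`kRep_comm_finiteRep`). [folklore] -/
theorem finiteRep_comm_kRep (h : 𝒟.finiteAdelic) (k : 𝒟.arch.maximalCompact) :
    π.finiteRep h ∘ₗ π.kRep k = π.kRep k ∘ₗ π.finiteRep h :=
  LinearMap.ext fun v => (π.kRep_comm_finiteRep k h v).symm

variable [StarModule ℝ A] [ContinuousStar A] [FiniteDimensional ℝ A]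

/-- **`H^q(𝔤, K_∞; π)`** — the relative Lie algebra cohomology of the `(𝔤, K_∞)`-module
`W / W'` of an automorphic representation (for a regular datum and its Lie algebra action
`ρ𝔤`, `π.HasLieAction ρ𝔤`; the compatibility axiom comes from
`isGKModule_of_hasLieAction_holds`). [cite: BorelWallach2000, I §5.1] -/
abbrev gkCohomology (h𝒟 : 𝒟.IsRegular) {ρ𝔤 : 𝒟.arch.lie →ₗ⁅ℝ⁆ Module.End ℂ π.Quot}
    (hρ : π.HasLieAction ρ𝔤) (q : ℕ) : Type _ :=
  Automorphic.gkCohomology 𝒟.arch π.kRep ρ𝔤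
    (π.isGKModule_of_hasLieAction_holds h𝒟 hρ).ad_compat q


/-- **`G(𝔸_f)` acts on `H^q(𝔤, K_∞; π)`** through right translations (which are
`(𝔤, K_∞)`-maps of `W / W'`). [cite: BorelJacquet1979, 4.6] [cite: BorelWallach2000, I §5.1] -/
def cohomologyRep (h𝒟 : 𝒟.IsRegular) {ρ𝔤 : 𝒟.arch.lie →ₗ⁅ℝ⁆ Module.End ℂ π.Quot}
    (hρ : π.HasLieAction ρ𝔤) (q : ℕ) :
    Representation ℂ 𝒟.finiteAdelic (π.gkCohomology h𝒟 hρ q) :=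
  gkCohomologyRep 𝒟.arch π.kRep ρ𝔤 _ π.finiteRep
    (fun h X => π.finiteRep_comm_of_hasLieAction hρ h X) (fun h k => π.finiteRep_comm_kRep h k) q

/-- Unfolding. [folklore] -/
theorem cohomologyRep_apply (h𝒟 : 𝒟.IsRegular) {ρ𝔤 : 𝒟.arch.lie →ₗ⁅ℝ⁆ Module.End ℂ π.Quot}
    (hρ : π.HasLieAction ρ𝔤) (q : ℕ) (h : 𝒟.finiteAdelic) :
    π.cohomologyRep h𝒟 hρ q h =
      gkCohomologyMap 𝒟.arch π.kRep ρ𝔤 _ (π.finiteRep h)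
        (π.finiteRep_comm_of_hasLieAction hρ h) (π.finiteRep_comm_kRep h) q := rfl

/-- **The `G(𝔸_f)`-action on `H^q(𝔤, K_∞; π)` is smooth**: a class is represented by a cocycle,
an alternating map on the finite-dimensional `𝔤`, which is determined by its finitely many
values on tuples of basis vectors; each value is fixed by an open subgroup of `G(𝔸_f)`
(`isSmooth_finiteRep_holds`), and the finite intersection of these fixes the class.
[cite: BorelJacquet1979, 4.6 with 4.2(a), 4.3] -/
theorem cohomologyRep_isSmooth (h𝒟 : 𝒟.IsRegular) {ρ𝔤 : 𝒟.arch.lie →ₗ⁅ℝ⁆ Module.End ℂ π.Quot}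
    (hρ : π.HasLieAction ρ𝔤) (q : ℕ) : (π.cohomologyRep h𝒟 hρ q).IsSmooth := by
  intro x
  obtain ⟨z, rfl⟩ := (gkComplex 𝒟.arch π.kRep ρ𝔤
    (π.isGKModule_of_hasLieAction_holds h𝒟 hρ).ad_compat).toCohomology_surjective q x
  -- a real basis of `𝔤`
  haveI : Module.Finite ℝ 𝒟.arch.lie :=
    Module.Finite.of_injective (𝒟.arch.lie.incl : 𝒟.arch.lie →ₗ⁅ℝ⁆ Matrix N N A).toLinearMap
      Subtype.val_injective
  let e := Module.finBasis ℝ 𝒟.arch.lie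
  -- the open subgroup fixing all values of the cocycle on basis tuples
  let S : Subgroup 𝒟.finiteAdelic :=
    ⨅ v : Fin q → Fin (Module.finrank ℝ 𝒟.arch.lie),
      π.finiteRep.stabilizerSubgroup ((z : ChevalleyEilenberg.Cochain ℝ 𝒟.arch.lie
        (GKCarrier 𝒟.arch ρ𝔤) q) fun i => e (v i))
  have hS : IsOpen (S : Set 𝒟.finiteAdelic) := by
    rw [Subgroup.coe_iInf]
    exact isOpen_iInter_of_finite fun v => π.isSmooth_finiteRep_holds h𝒟 _
  refine (π.cohomologyRep h𝒟 hρ q).isSmoothVector_of_le hS fun h hh => ?_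
  rw [Representation.mem_stabilizerSubgroup, cohomologyRep_apply,
    gkCohomologyMap_eq_gkCohomologyHom, gkCohomologyHom_apply,
    ChevalleyEilenberg.Subcomplex.IsCochainMapTo.cohomologyMap_toCohomology]
  congr 1
  refine Subtype.ext ?_
  rw [ChevalleyEilenberg.Subcomplex.IsCochainMapTo.coe_cocyclesMap]
  refine Module.Basis.ext_alternating e fun v _ => ?_
  rw [ChevalleyEilenberg.map_apply, GKCarrier.hom_apply]
  exact (Subgroup.mem_iInf.mp hh) v

end AutomorphicRepData

end Literature.NumberTheory.Automorphic
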